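import Summits.PneNP.PneNP.Theses.OneSlice
import Summits.PneNP.PneNP.Theorems.ConstantBand.Negative.LoadBearing
import Literature.Computability.Complexity.RossmanMonotoneCliqueGraphs

/-!
# Line `flat-prior-relative-minterms` for crux `ConstantBand` (stmt-PneNP-2834, route PneNP/OneSlice)

Crux (by name): `Summit.PneNP.PneNP.Theses.OneSlice.ConstantBand` —
`∀ c, ∃ k ≥ 3, ∃ w, ∃ δ > 0, ∀ᶠ n, ∀ central j, ∀ {∧₂,∨₂}-circuit C, bandErr ≤ δ → n^c < |C|`.

Idea (card `Cruxes/ConstantBand/Ideas/flat-prior-relative-minterms.md`, triage r1: pass/pass/pass):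
the band prior is FLAT (the slice index is uniform), so the exact edge count leaks only `C(k,2)/(2w+1)` of
total variation about a planted `k`-clique, once; together with near-clique CONTIGUITY (planting `K_k` minus
an edge into a critical slice is invisible, strict balance of `K_k`) this makes `K_A` a GENUINE minterm of the
relativised function `C(x ∪ ·)` for a constant fraction of pairs `(x, A)` whenever a monotone `C` accepts
planted pairs but rejects half of the band (`RelMintermPlanted`, Rossman's Lemma 15 at ONE law). The crux then
follows from ONE structural engine — small monotone circuits have few relative clique-minterms under the band
law (`RelMintermSparse`, the one-law relativised Lemmas 9–17 of Rossman FOCS'10 with a junk filter; the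
hardest stub) — through the Theorem-1-shaped transfer target `BandPair` (the card's C⁺) and the slice form of
Rossman's Lemma 23 (`SliceLemma23`, Cauchy–Schwarz with `E[ω_k²]/E[ω_k]² → 1 + k!`).

Skeleton: the obligations are the named `def … : Prop` below; the REGISTERED STUBS are the five sorried
`theorem stub_… : <statement expanded> := by sorry` (each definitionally its named statement: `…_holds`); the
composition `ConstantBand_of` (hypotheses = the five statements keyed by their stub names, `Registered.stub_…`,
conclusion = the crux BY NAME) and `bandPair_of` are real proofs; the assembled skeleton is the final `example`.

Disproof.lean (standing disprover gen 1, cycles 1–2) honoured: §0 schedule form / "∃ w = all large w" — every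
obligation is stated "∃ w₀, ∀ w ≥ w₀" or "∀ w" and `bandPair_of` takes `w = max w₀ w₁ ⊔ C(k,2)`; §1 basis —
`C.IsOver monotoneBasis` is kept in `RelMintermSparse`/`BandPair` and monotonicity of `C.eval` is USED in
`bandPair_of` (`Circuit.monotone_eval_of_isOver_monotoneBasis`); §2 centrality — every probabilistic stub is
stated for `Central k n j` only (`SliceLemma23`, `NearCliqueContiguity`, the first-moment bound inside
`TransferStep` are false off the window); §3 `le_of_bandLB` (c ≤ k+2) — `RelMintermSparse`/`BandPair` are
`∀ c ∃ k`, the exact DNF (size ≤ n^{k+3}) has relative-minterm density ≈ 1 − 1/k! > 1/2, so the engine's `k`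
must exceed `c − 3`, consistent; §4 δ-floor — `TransferStep` produces `δ ≤ min(γ²/(4(k!+2)), 1/6)`, far below
`(2w+1)/k!`; §5 band pseudo-complements — the named residual of `RelMintermSparse` (count-threshold gates
`T_{≥θ}` relativised at slice `θ − C(k,2)` have every `C(k,2)`-set as a relative minterm: density
`1/#lowerBand`, killed only by `w → ∞`) is exactly the scale-`≤ w` negation the band withholds.
No `-- Targets` stub kill and no landed `Negative/` lemma exists for this crux yet (checked `ledger crux ls`).
-/

set_option linter.dupNamespace false

namespace Summit.PneNP.PneNP.Cruxes.ConstantBand.FlatPriorRelativeMinterms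

open Literature.Computability.Complexity Finset Filter Classical
open Summit.PneNP.PneNP.Theses.OneSlice (ConstantBand)

noncomputable section

/-! ## Vocabulary (finite sums only; every measure is a counting fraction)

LEAD RESHAPE (prover-line-stmt-PneNP-2834-0, 2026-08-16): `Edge`, `thr`, `Central`, `slice`, `errSet`, `bandErr`,
`BandLB`, `constantBand_iff` are RE-EXPORTED from the landed `Theorems/ConstantBand/Negative/LoadBearing.lean` (not
re-declared); the remaining vocabulary and the named obligations below are proposed verbatim as
`Theorems/OneSliceConstantBandDefs.lean` (same namespace) and this block is deleted in favour of that import once it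
lands. Stub S1 is restated with an EXISTENTIAL constant `L = L(k)` in place of `k! + 1 + ε` (all the transfer S5
consumes; provable from the tree's `sum_erase_pow_inter_le` / `le_choose_mul_threshold_pow` without the Poisson
asymptotics `E ω_k → 1/k!`). -/

export Summit.PneNP.PneNP.Theorems.ConstantBand.Negative
  (Edge thr Central central_thr slice errSet bandErr BandLB constantBand_iff bandErr_nonneg)

/-- The band of slice indices `[j − w, j + w]` (ℕ-truncated exactly as in the crux). [folklore] -/
def band (j w : ℕ) : Finset ℕ := Icc (j - w) (j + w)

/-- The LOWER band `[j − w, j + w − C(k,2)]`: the slices from which a whole planted `k`-clique still lands in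
the band. [folklore] -/
def lowerBand (k j w : ℕ) : Finset ℕ := Icc (j - w) (j + w - k.choose 2)

/-- `P_{x ∼ G(n,i)}[P x]`: the uniform (counting) probability of an event on the slice `i`
(junk value `0` on an empty slice, `i > C(n,2)`). [folklore] -/
def sliceProb (n i : ℕ) (P : (Edge n → Bool) → Prop) : ℝ :=
  (#((slice n i).filter P) : ℝ) / (#(slice n i) : ℝ)

/-- The PLANTED-PAIR measure of the line: `x` uniform on the slice `i`, `A` an independent uniform `k`-subset
of the vertices; `P_{(x,A)}[P x A]` as a counting fraction. [folklore] -/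
def pairProb (n k i : ℕ) (P : (Edge n → Bool) → Finset (Fin n) → Prop) : ℝ :=
  (#(((slice n i) ×ˢ powersetCard k (univ : Finset (Fin n))).filter fun xa => P xa.1 xa.2) : ℝ) /
    ((#(slice n i) : ℝ) * (n.choose k : ℝ))

/-- The triple measure: `(x, A)` as in `pairProb` and `e` a uniform edge of `K_A` (`e ∈ edgesIn A`, `C(k,2)`
of them); used to average over the `C(k,2)` maximal proper sub-plantings `x ∪ (K_A − e)`. [folklore] -/
def tripleProb (n k i : ℕ) (P : (Edge n → Bool) → Finset (Fin n) → Edge n → Prop) : ℝ :=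
  (#((((slice n i) ×ˢ powersetCard k (univ : Finset (Fin n))) ×ˢ (univ : Finset (Edge n))).filter
      fun t => t.2 ∈ edgesIn t.1.2 ∧ P t.1.1 t.1.2 t.2) : ℝ) /
    ((#(slice n i) : ℝ) * (n.choose k : ℝ) * (k.choose 2 : ℝ))

/-- Planting `K_A` minus the edge `e`: `x ∪ (K_A − e)` (a maximal proper sub-planting when `e ∈ K_A ∖ x`).
[folklore] -/
def plantSub {n : ℕ} (A : Finset (Fin n)) (e : Edge n) (x : Edge n → Bool) : Edge n → Bool :=
  fun e' => x e' || (cliqueVec A e' && decide (e' ≠ e))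

/-- `K_A` is a RELATIVE MINTERM of `f` at the background `x`: `f(x) = 0`, `f(x ∪ K_A) = 1`, and every `y` with
`x ≤ y < x ∪ K_A` has `f(y) = 0` — i.e. `K_A ∖ x` is a genuine minterm of the relativised monotone function
`f^x := f(x ∪ ·)` (Rossman FOCS'10 §6: "`k`-cliques as minterms of `C̄`", relativised). [folklore] -/
def IsRelMinterm {n : ℕ} (f : (Edge n → Bool) → Bool) (x : Edge n → Bool) (A : Finset (Fin n)) : Prop :=
  f x = false ∧ f (plantClique A x) = true ∧
    ∀ y : Edge n → Bool, x ≤ y → y ≤ plantClique A x → y ≠ plantClique A x → f y = false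

/-- The crux in schedule form: `∀ c, ∃ k ≥ 3, ∃ w, ∃ δ > 0, BandLB c k w δ` — the right-hand side of the
disprover's `constantBand_iff : ConstantBand ↔ ConstantBandSchedule` (`Iff.rfl`). [folklore] -/
def ConstantBandSchedule : Prop :=
  ∀ c : ℕ, ∃ k : ℕ, 3 ≤ k ∧ ∃ w : ℕ, ∃ δ : ℝ, 0 < δ ∧ BandLB c k w δ

/-! ## The transfer target C⁺ = `BandPair` (one law, Theorem-1 shape: hypothesis on planted positives only) -/

/-- **BandPair** (the card's C⁺). For every exponent `c` there are `k ≥ 3`, a width `w` and `γ > 0` such that,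
eventually in `n`, for every central `j` and every `{∧₂,∨₂}`-circuit `C` of size `≤ n^c`: if `C` rejects at
most a `γ`-fraction of the planted pairs `x ∪ K_A` (`x` uniform on a lower-band slice, each slice weighted
equally, `A` a uniform `k`-set), then `C` accepts MORE THAN HALF of the band (slices weighted equally).
Strictly stronger than the crux (it constrains every planted-pair acceptor, accurate or not); every band
threshold `T_{≥θ}` satisfies it once `2w+1 > 4·C(k,2)` (flat prior), and it is typed in the "(accept planted
≥ 1−γ) ⇒ (accept band > 1/2)" form because the INDISTINGUISHABILITY form is false on the band
(`T_{≥ j−w+C(k,2)}` has advantage `C(k,2)/(2w+1)`). [folklore] -/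
def BandPair : Prop :=
  ∀ c : ℕ, ∃ k : ℕ, 3 ≤ k ∧ ∃ w : ℕ, ∃ γ : ℝ, 0 < γ ∧ ∀ᶠ n : ℕ in atTop, ∀ j : ℕ, Central k n j →
    ∀ C : Circuit (Edge n), C.IsOver monotoneBasis → C.size ≤ n ^ c →
      ∑ i ∈ lowerBand k j w, pairProb n k i (fun x A => C.eval (plantClique A x) = false)
          ≤ γ * #(lowerBand k j w) →
      ∑ i ∈ band j w, sliceProb n i (fun x => C.eval x = false) < (1 / 2 : ℝ) * #(band j w)

/-! ## Obligations (the named statements of the line; each stub below is one of them, expanded) -/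

/-- **S1 · slice Lemma 23** (planted vs uniform on ONE slice, Cauchy–Schwarz form; size M). For `k ≥ 3`, any
width `w` and `ε > 0`, eventually in `n`: for central `j`, every band slice `i` and EVERY `f` (no monotonicity,
no size), `P_{x ∼ G(n,i), A}[f(x ∪ K_A) = 0] ≤ √(L · P_{y ∼ G(n,i+C(k,2))}[f(y) = 0 ∧ CLIQUE_k(y)]) + ε` for SOME
constant `L = L(k)` (lead reshape: the transfer only needs a `k`-dependent constant; `L = 2^k k!·2^K(1 + k 2^k 2^K)`,
`K = C(k,2)`, works from the tree's `sum_erase_pow_inter_le` and `le_choose_mul_threshold_pow`).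
Why true: off the overlap event `K_A ∩ x ≠ ∅` (probability `≤ C(k,2)·i/C(n,2) → 0`) the law of `x ∪ K_A` has
density `ω_k(y)/E[ω_k]·(1+o(1))` w.r.t. the uniform law on slice `i + C(k,2)`, it vanishes off `{ω_k ≥ 1}`, and
`E_i[ω_k²]/E_i[ω_k]² → 1 + k!` uniformly on central bands (strict balance of `K_k`: every overlap type
`2 ≤ a ≤ k−1` contributes `n^{-a(1-(a-1)/(k-1))} → 0`; `E ω_k → 1/k!`). The `G(n,p)` twin is the computation
behind `Rossman2010_plantedVsConditioned_holds` (Rossman FOCS'10 Lemma 23); here with falling factorials. -/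
def SliceLemma23 : Prop :=
  ∀ k : ℕ, 3 ≤ k → ∃ L : ℝ, 0 < L ∧ ∀ w : ℕ, ∀ ε : ℝ, 0 < ε → ∀ᶠ n : ℕ in atTop, ∀ j : ℕ, Central k n j →
    ∀ i ∈ band j w, ∀ f : (Edge n → Bool) → Bool,
      pairProb n k i (fun x A => f (plantClique A x) = false) ≤
        Real.sqrt (L * sliceProb n (i + k.choose 2) (fun y => f y = false ∧ cliqueFn n k y = true)) + ε

/-- **S2 · near-clique contiguity** (size M; the brick shared with cards near-clique-pivot /
critical-closure-pivotal-descent). For `k ≥ 3`, any `w`, `ε > 0`, eventually in `n`: for central `j`, every band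
slice `i` and every event `S`, `P_{(x,A,e)}[x ∪ (K_A − e) ∈ S] ≤ P_{y ∼ G(n, i + C(k,2) − 1)}[y ∈ S] + ε` —
planting `K_k` minus one edge into a critical slice is invisible (one-sided TV → 0). Why true: the likelihood
ratio is `X(y)/E[X]·(1+o(1))` with `X(y) = #{(A,e) : K_A − e ⊆ y}`, `E X ≍ (C(k,2)/k!)·n^{2/(k-1)} → ∞` and
`Var X/(E X)² → 0` because EVERY subpattern of `K_k^-` with `v` vertices has `n^v p^{e} → ∞` at
`p = n^{-2/(k-1)}` (`v ≤ k−1`: `n^{v(k−v)/(k−1)}`; `v = k`: `n^{2/(k−1)}`); kit jobs j010586 / j010621 of the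
triage confirm `Var/E² ≈ k!·p/C(k,2)` exactly. -/
def NearCliqueContiguity : Prop :=
  ∀ k : ℕ, 3 ≤ k → ∀ w : ℕ, ∀ ε : ℝ, 0 < ε → ∀ᶠ n : ℕ in atTop, ∀ j : ℕ, Central k n j →
    ∀ i ∈ band j w, ∀ S : Finset (Edge n → Bool),
      tripleProb n k i (fun x A e => plantSub A e x ∈ S) ≤
        sliceProb n (i + k.choose 2 - 1) (fun y => y ∈ S) + ε

/-- **RelMintermPlanted** — the relative-minterm lemma in planted-acceptance normalisation (Rossman's Lemma 15
at ONE law, relativised). For `k ≥ 3` and `γ > 0` there is `w₀` such that for every `w ≥ w₀`, eventually in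
`n`: for central `j` and every MONOTONE `f`, if `f` rejects at most a `γ`-fraction of the planted pairs from the
lower band and rejects at least half of the band, then `K_A` is a relative minterm of `f` at `x` for at least a
`(1/2 − 2γ)`-fraction of the lower-band pairs `(x, A)`. Proof route (`RelMintermStep`): lower-bound the good
event `f x = 0 ∧ f(x ∪ K_A) = 1 ∧ ∀ e ∈ K_A, f(x ∪ (K_A − e)) = 0` (it implies `IsRelMinterm` for monotone `f`)
by `Σ_lower P[f x = 0] − γ·#lower − C(k,2)·Σ_lower (tripleProb[f(x ∪ (K_A−e)) = 1] − P_i[f = 1])`; the first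
term is `≥ #band/2 − C(k,2) ≥ #lower/2 − C(k,2)`; by `NearCliqueContiguity` and the FLAT PRIOR (telescoping:
`Σ_{i ∈ lower} (a_f(i + C(k,2) − 1) − a_f(i)) ≤ C(k,2) − 1` for any `[0,1]`-valued `a_f`) the last term is
`≤ C(k,2)(C(k,2) − 1) + C(k,2)·ε·#lower`; take `ε = γ/(2C(k,2))`, `w₀ = C(k,2) + ⌈2C(k,2)²/γ⌉`. [folklore] -/
def RelMintermPlanted : Prop :=
  ∀ k : ℕ, 3 ≤ k → ∀ γ : ℝ, 0 < γ → ∃ w₀ : ℕ, ∀ w : ℕ, w₀ ≤ w → ∀ᶠ n : ℕ in atTop, ∀ j : ℕ,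
    Central k n j → ∀ f : (Edge n → Bool) → Bool, Monotone f →
      ∑ i ∈ lowerBand k j w, pairProb n k i (fun x A => f (plantClique A x) = false)
          ≤ γ * #(lowerBand k j w) →
      (1 / 2 : ℝ) * #(band j w) ≤ ∑ i ∈ band j w, sliceProb n i (fun x => f x = false) →
      (1 / 2 - 2 * γ) * #(lowerBand k j w) ≤
        ∑ i ∈ lowerBand k j w, pairProb n k i (IsRelMinterm f)

/-- **S3 · the relative-minterm step** (size M): near-clique contiguity (+ flat prior + monotonicity + a union
bound over the `C(k,2)` maximal sub-plantings) gives `RelMintermPlanted`. No circuit enters. -/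
def RelMintermStep : Prop :=
  NearCliqueContiguity → RelMintermPlanted

/-- **S4 · the ENGINE — relative clique-minterms of small monotone circuits are sparse under the band law**
(size XL, the hardest stub; OPEN). For every `c` there are `k ≥ 3`, a constant `ρ < 1/2` and `w₁` such that for
every `w ≥ w₁`, eventually in `n`: for central `j` and every `{∧₂,∨₂}`-circuit of size `≤ n^c`, `K_A` is a
relative minterm of `C.eval` at `x` for at most a `ρ`-fraction of the lower-band pairs `(x, A)`. This is the
one-law, relativised form of Rossman FOCS'10 §5–7 (closure of the gates w.r.t. the band law; relativised
Lemma 14: a relative minterm of `f ∧ g` is a union of two relative minterms; Lemma 9/16 caps on medium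
minterms of closed functions) and needs exactly ONE new ingredient — a junk filter excluding the relative
minterms supplied by count-threshold-like gates (a `T_{≥θ}` relativised at slice `θ − e_F` has every `e_F`-set
of non-edges as a relative minterm) — cf. cards forcing-contrast-hole-cap (C)+(D)+(J)+(H) and
critical-closure-pivotal-descent (`pivotal_descent` + service bound), which are candidate engines for THIS
statement. Necessary features (checked): `ρ` cannot be `o(1)` at fixed `w` (global thresholds give density
`1/#lowerBand`), `k` must exceed `c − 3` (exact DNF), and the natural conjecture is density `O(C(k,2)/w) + o(1)`.
Up to the flat-prior/contiguity slack it is EQUIVALENT to "no size-`n^c` monotone circuit has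
`P[C(x ∪ K_A) = 1] − P[C(x) = 1] ≥ ρ′` on the lower band" (distinguishing form), hence strictly stronger than
`BandPair` and than the crux; it is NOT implied by anything in the tree. -/
def RelMintermSparse : Prop :=
  ∀ c : ℕ, ∃ k : ℕ, 3 ≤ k ∧ ∃ ρ : ℝ, ρ < 1 / 2 ∧ ∃ w₁ : ℕ, ∀ w : ℕ, w₁ ≤ w → ∀ᶠ n : ℕ in atTop,
    ∀ j : ℕ, Central k n j → ∀ C : Circuit (Edge n), C.IsOver monotoneBasis → C.size ≤ n ^ c →
      ∑ i ∈ lowerBand k j w, pairProb n k i (IsRelMinterm C.eval) ≤ ρ * #(lowerBand k j w)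

/-- **S5 · the transfer `BandPair → ConstantBand`** (size M; the card's `bandPair_implies`), modulo slice
Lemma 23. Given `c`, take BandPair's `(k, w, γ)`, S1's constant `L = L(k)` and `δ := min (γ²/(4L)) (1/6)`; for a `δ`-accurate
monotone `C` of size `≤ n^c` on a central band: (i) by `SliceLemma23` (at `ε ≤ γ/2`) and Cauchy–Schwarz over the
lower band, planted rejection `≤ (√(Lδ) + ε)·#lower ≤ γ·#lower`; (ii) by the FIRST-MOMENT bound
`P_i[CLIQUE_k = 1] ≤ E_i[ω_k] ≤ C(n,k)(i/C(n,2))^{C(k,2)} ≤ 2/k!` on central bands eventually (hypergeometric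
tail; the tools of `Disproof.lean` §4 / `CliqueThresholdBounds.choose_mul_threshold_pow_le`) and accuracy,
band rejection `≥ (1 − 2/k!)·#band − δ ≥ #band/2`; BandPair's conclusion is contradicted, so `n^c < |C|`. -/
def TransferStep : Prop :=
  SliceLemma23 → BandPair → ConstantBandSchedule

/-! ## Registered stubs (statements expanded; `sorry` lives here and nowhere else) -/

/-- stub S1 (M): slice Lemma 23 — `SliceLemma23` expanded. -/
theorem stub_sliceLemma23 :
    ∀ k : ℕ, 3 ≤ k → ∃ L : ℝ, 0 < L ∧ ∀ w : ℕ, ∀ ε : ℝ, 0 < ε → ∀ᶠ n : ℕ in atTop, ∀ j : ℕ, Central k n j →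
      ∀ i ∈ band j w, ∀ f : (Edge n → Bool) → Bool,
        pairProb n k i (fun x A => f (plantClique A x) = false) ≤
          Real.sqrt (L * sliceProb n (i + k.choose 2) (fun y => f y = false ∧ cliqueFn n k y = true)) + ε := by
  sorry

/-- stub S2 (M): near-clique contiguity on the slice — `NearCliqueContiguity` expanded. -/
theorem stub_nearCliqueContiguity :
    ∀ k : ℕ, 3 ≤ k → ∀ w : ℕ, ∀ ε : ℝ, 0 < ε → ∀ᶠ n : ℕ in atTop, ∀ j : ℕ, Central k n j →
      ∀ i ∈ band j w, ∀ S : Finset (Edge n → Bool),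
        tripleProb n k i (fun x A e => plantSub A e x ∈ S) ≤
          sliceProb n (i + k.choose 2 - 1) (fun y => y ∈ S) + ε := by
  sorry

/-- stub S3 (M): contiguity + flat prior ⇒ relative minterms — `RelMintermStep` expanded one level. -/
theorem stub_relMintermStep :
    NearCliqueContiguity → RelMintermPlanted := by
  sorry

/-- stub S4 (XL, HARDEST, open): sparsity of relative clique-minterms of small monotone circuits under the band law — `RelMintermSparse` expanded. -/
theorem stub_relMintermSparse :
    ∀ c : ℕ, ∃ k : ℕ, 3 ≤ k ∧ ∃ ρ : ℝ, ρ < 1 / 2 ∧ ∃ w₁ : ℕ, ∀ w : ℕ, w₁ ≤ w → ∀ᶠ n : ℕ in atTop,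
      ∀ j : ℕ, Central k n j → ∀ C : Circuit (Edge n), C.IsOver monotoneBasis → C.size ≤ n ^ c →
        ∑ i ∈ lowerBand k j w, pairProb n k i (IsRelMinterm C.eval) ≤ ρ * #(lowerBand k j w) := by
  sorry

/-- stub S5 (M): the transfer `BandPair → ConstantBand` via slice Lemma 23 and the first moment — `TransferStep` expanded one level. -/
theorem stub_transferStep :
    SliceLemma23 → BandPair → ConstantBandSchedule := by
  sorry

/-! ## Consistency: each named statement IS its registered stub (definitionally) -/

/-- `SliceLemma23` is definitionally stub S1. -/
theorem sliceLemma23_holds : SliceLemma23 := stub_sliceLemma23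
/-- `NearCliqueContiguity` is definitionally stub S2. -/
theorem nearCliqueContiguity_holds : NearCliqueContiguity := stub_nearCliqueContiguity
/-- `RelMintermStep` is definitionally stub S3. -/
theorem relMintermStep_holds : RelMintermStep := stub_relMintermStep
/-- `RelMintermSparse` is definitionally stub S4. -/
theorem relMintermSparse_holds : RelMintermSparse := stub_relMintermSparse
/-- `TransferStep` is definitionally stub S5. -/
theorem transferStep_holds : TransferStep := stub_transferStep

/-! ## Name-keyed aliases (the skeleton audit admits a hypothesis of the composition only if its head constant is a
registered obligation or is NAMED like a declared stub; gate-reserved tags are not available to a Line file) -/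
namespace Registered

/-- Alias of `SliceLemma23` keyed by the registered stub name. -/
abbrev stub_sliceLemma23 : Prop := SliceLemma23
/-- Alias of `NearCliqueContiguity` keyed by the registered stub name. -/
abbrev stub_nearCliqueContiguity : Prop := NearCliqueContiguity
/-- Alias of `RelMintermStep` keyed by the registered stub name. -/
abbrev stub_relMintermStep : Prop := RelMintermStep
/-- Alias of `RelMintermSparse` keyed by the registered stub name. -/
abbrev stub_relMintermSparse : Prop := RelMintermSparse
/-- Alias of `TransferStep` keyed by the registered stub name. -/
abbrev stub_transferStep : Prop := TransferStep

end Registered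

/-! ## Composition (real proofs) -/

/-- For `C(k,2) ≤ w` the centre `j` lies in the lower band, so the lower band is non-empty. -/
theorem mem_lowerBand_self {k j w : ℕ} (hw : k.choose 2 ≤ w) : j ∈ lowerBand k j w := by
  simp only [lowerBand, mem_Icc]
  omega

/-- **BandPair from the brick and the engine.** Given `c`, the engine supplies `k`, `ρ < 1/2`, `w₁`; put
`γ := (1/2 − ρ)/4`, take `w₀` from `RelMintermPlanted` and `w := max (max w₀ w₁) C(k,2)`. A small monotone `C`
accepting all but `γ` of the planted pairs yet rejecting half the band would have relative-minterm density
`≥ 1/2 − 2γ = 1/4 + ρ/2 > ρ` on a non-empty lower band — contradiction. -/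
theorem bandPair_of (hR : RelMintermPlanted) (hS : RelMintermSparse) : BandPair := by
  intro c
  obtain ⟨k, hk, ρ, hρ, w₁, hSw⟩ := hS c
  set γ : ℝ := (1 / 2 - ρ) / 4 with hγ
  have hγ0 : 0 < γ := by rw [hγ]; linarith
  obtain ⟨w₀, hRw⟩ := hR k hk γ hγ0
  set w : ℕ := max (max w₀ w₁) (k.choose 2) with hwdef
  have hw₀ : w₀ ≤ w := le_trans (le_max_left _ _) (le_max_left _ _)
  have hw₁ : w₁ ≤ w := le_trans (le_max_right _ _) (le_max_left _ _)
  have hwk : k.choose 2 ≤ w := le_max_right _ _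
  refine ⟨k, hk, w, γ, hγ0, ?_⟩
  filter_upwards [hRw w hw₀, hSw w hw₁] with n hRn hSn
  intro j hj C hC hsize hplanted
  by_contra hband
  push Not at hband
  have hmono : Monotone C.eval := C.monotone_eval_of_isOver_monotoneBasis hC
  have h1 := hRn j hj C.eval hmono hplanted hband
  have h2 := hSn j hj C hC hsize
  have hL : (1 : ℝ) ≤ #(lowerBand k j w) := by
    have : 1 ≤ #(lowerBand k j w) := card_pos.2 ⟨j, mem_lowerBand_self hwk⟩
    exact_mod_cast this
  have h3 : (1 / 2 - 2 * γ) * (#(lowerBand k j w) : ℝ) ≤ ρ * #(lowerBand k j w) := h1.trans h2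
  have h4 : (1 / 2 - 2 * γ : ℝ) = 1 / 4 + ρ / 2 := by rw [hγ]; ring
  rw [h4] at h3
  nlinarith [mul_pos (by linarith : (0 : ℝ) < 1 / 4 - ρ / 2) (by linarith : (0 : ℝ) < #(lowerBand k j w))]

/-- **The composition**: the five obligations imply the crux, concluded BY NAME. -/
theorem ConstantBand_of (h₁ : Registered.stub_sliceLemma23) (h₂ : Registered.stub_nearCliqueContiguity)
    (h₃ : Registered.stub_relMintermStep) (h₄ : Registered.stub_relMintermSparse)
    (h₅ : Registered.stub_transferStep) : ConstantBand :=
  constantBand_iff.2 (h₅ h₁ (bandPair_of (h₃ h₂) h₄))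

/-- Wiring check — the assembled skeleton: the registered stubs feed `ConstantBand_of` as stated (an `example`, so
that `ConstantBand_of` stays the only named theorem of this file concluding the crux). -/
example : ConstantBand :=
  ConstantBand_of stub_sliceLemma23 stub_nearCliqueContiguity stub_relMintermStep stub_relMintermSparse
    stub_transferStep

end

end Summit.PneNP.PneNP.Cruxes.ConstantBand.FlatPriorRelativeMinterms
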